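import Summits.QuantumFields.BalabanUV.T4Continuum.Support.NE7StabiliserLiftingUniformOfNearFlat
import Summits.QuantumFields.BalabanUV.T4Continuum.Support.AveragingDeficitFermat
import HarnessLib

/-!
# NE7CombLoopReconstruction — LOOP COORDINATES ON THE PERIODIC LATTICE: a periodic configuration is RECONSTRUCTED from its based loop variables
# `ℓ(r,κ) = A(r)·V(x_r,κ)·A(r′)⁻¹` and any residue-indexed transport `A`; the reconstruction of an ARBITRARY residue-indexed family `f` is periodic, its
# plaquette holonomies are the conjugated plaquette WORDS of `f`, it is bondwise as close to `V` as `f` is to `ℓ`, and it is FIXED by every gauge field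
# `s(x) = A(x̄)⁻¹ s₀ A(x̄)` with `s₀` commuting with `f` — which is the shape of EVERY stabiliser element of `V` when `A` is the axial transport
# (file S3c-1 of the `k`-uniform stabiliser lifting programme: the lattice side of (NEAR-FLAT_K))

Cell `pub-balaban`, rung (B)+1 sub-cell t4, lineage `b2b-balaban-t4-ne7b-p1` (row NE7b OWNER + CRUX PROVER; junction service for row NE7, ruling R-OWNER-149-1 (2)),
generation 159.  Memo `t4/b2b-balaban-t4-ne7b-p1/g159/records/S3-BRIEF.md` §2 (c).
WHY.  The remaining letter (NEAR-FLAT_K) of ✓ `NE7StabiliserLiftingUniformOfNearFlat` asks, near an almost-flat datum `V`, for a FLAT datum fixed by every stabiliser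
element of `V`.  In loop coordinates the stabiliser of `V` is «constants `s₀` commuting with every loop variable», conjugated along the axial tree (§3); so a flat
symmetric datum is RECONSTRUCTED from any family `f` of unitaries with trivial plaquette words that commutes with the commutant of the loop variables (§2) — the
matrix-analysis letter «almost commuting unitaries are near exactly commuting ones inside their bicommutant» then finishes (S3b; ✓ `NE7AlmostProjection` is its
first brick).
WHAT ([folklore]; 0 def, 0 sorry; generic `d`, every `U(n)`; `A : (Fin d → Fin N) → (Matrix n n ℂ)ˣ` an arbitrary residue-indexed transport).  §1 residue arithmetic
(`redN_boxVec_redN_add`, `apply_boxVec_redN`, `site_apply_boxVec_redN`); §2 the reconstruction `x κ ↦ A(x̄)⁻¹ f(x̄,κ) A((x+e_κ)‾)`: **`recon_loop`** (of the loop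
family of `V` it is `V`), `isPeriodicCfg_recon`, `isUnitaryCfg_recon`, **`hol_recon_plaqWord`** (plaquette holonomy = conjugated plaquette word of `f`),
**`smallField_zero_recon`** (flat when the words are `1`), **`gaugeAct_recon_of_conj`** (fixed by `s = A⁻¹s₀A` when `s₀` commutes with `f`),
**`norm_recon_inv_mul_sub_one`** (`‖recon(f)(b)⁻¹V(b) − 1‖ = ‖ℓ(b) − f(b)‖`); §3 with the AXIAL transport `A(r) = hol V 0 (treeWord x_r)`: **`stab_eq_conj_axial`**
(every periodic `s` fixing `V` is `s(x) = A(x̄)⁻¹ s(0) A(x̄)`) and **`commute_loop_of_stab`** (`s(0)` commutes with every loop variable).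
HONEST FRAMING (page 1): lattice kinematics; nothing of Bałaban's; NOT (NEAR-FLAT_K), NOT NE7, NOT NE3; row NE7b NOT PRINTED ∕ NOT PROVED; spine 0∕9; finite T⁴ rung
(B)+1 — NOT infinite volume, NOT mass gap, NOT BetaPertH, NOT Clay.
-/

set_option autoImplicit false

open scoped BigOperators Matrix Matrix.Norms.L2Operator

namespace Summit.QuantumFields.BalabanUV.T4Continuum.NE7CombLoopReconstruction

open Literature.MathematicalPhysics.QuantumFieldTheory.Balaban1983to89
open B7Prop1Explicit B7Prop2Explicit
open T4AveragingDeficitWall (IsUnitaryCfg SmallField)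
open T4AveragingDeficitWallBoundary (IsPeriodicCfg)
open AveragingDeficitTorusChart (redN redN_boxVec redN_add_smul eq_wrap_add periodic_smul_vec)
open NE3EnergyShapes (IsUnitarySite IsPeriodicSite)

noncomputable section

variable {d : ℕ} {n : Type} [Fintype n] [DecidableEq n]

/-! ## §1 Residue arithmetic -/

/-- `(x̄ + v)‾ = (x + v)‾` for the box representative `x̄ = boxVec (redN x)`. [folklore] -/
theorem redN_boxVec_redN_add (N : ℕ) [NeZero N] (x v : Site d) : redN N (boxVec N (redN N x) + v) = redN N (x + v) := by
  have h := eq_wrap_add (d := d) N x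
  have h2 : boxVec N (redN N x) + v = (x + v) + (N : ℤ) • (-(fun i => x i / (N : ℤ))) := by
    calc boxVec N (redN N x) + v
        = (boxVec N (redN N x) + (N : ℤ) • (fun i => x i / (N : ℤ))) + v + -((N : ℤ) • (fun i => x i / (N : ℤ))) := by abel
      _ = x + v + -((N : ℤ) • (fun i => x i / (N : ℤ))) := by rw [← h]
      _ = (x + v) + (N : ℤ) • (-(fun i => x i / (N : ℤ))) := by rw [smul_neg]
  rw [h2, redN_add_smul]

/-- A periodic configuration is read on the box representative: `V(x̄, κ) = V(x, κ)`. [folklore] -/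
theorem apply_boxVec_redN (N : ℕ) [NeZero N] {V : Site d → Fin d → (Matrix n n ℂ)ˣ} (hV : IsPeriodicCfg V (N : ℤ)) (x : Site d) (κ : Fin d) :
    V (boxVec N (redN N x)) κ = V x κ := by
  have h := eq_wrap_add (d := d) N x
  have hper : ∀ (y : Site d) (i : Fin d), (fun z => V z κ) (y + (N : ℤ) • e i) = (fun z => V z κ) y := fun y i => hV y i κ
  have h2 := periodic_smul_vec (f := fun z => V z κ) hper (boxVec N (redN N x)) (fun i => x i / (N : ℤ))
  rw [← h] at h2
  exact h2.symm

/-- A periodic site field is read on the box representative: `s(x̄) = s(x)`. [folklore] -/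
theorem site_apply_boxVec_redN (N : ℕ) [NeZero N] {s : Site d → (Matrix n n ℂ)ˣ} (hs : IsPeriodicSite s (N : ℤ)) (x : Site d) :
    s (boxVec N (redN N x)) = s x := by
  have h := eq_wrap_add (d := d) N x
  have h2 := periodic_smul_vec (f := s) hs (boxVec N (redN N x)) (fun i => x i / (N : ℤ))
  rw [← h] at h2
  exact h2.symm

/-! ## §2 The reconstruction from a residue-indexed family and a residue-indexed transport -/

/-- **RECONSTRUCTION OF `V` FROM ITS LOOP FAMILY**: for `V` `N`-periodic and ANY transport `A`,
`A(x̄)⁻¹ · [A(x̄) V(x̄_rep, κ) A((x̄_rep + e_κ)‾)⁻¹] · A((x + e_κ)‾) = V(x, κ)`. [folklore] -/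
theorem recon_loop (N : ℕ) [NeZero N] (A : (Fin d → Fin N) → (Matrix n n ℂ)ˣ) {V : Site d → Fin d → (Matrix n n ℂ)ˣ}
    (hV : IsPeriodicCfg V (N : ℤ)) (x : Site d) (κ : Fin d) :
    (A (redN N x))⁻¹ * (A (redN N x) * V (boxVec N (redN N x)) κ * (A (redN N (boxVec N (redN N x) + e κ)))⁻¹) * A (redN N (x + e κ))
      = V x κ := by
  rw [redN_boxVec_redN_add, apply_boxVec_redN N hV]
  group

/-- The reconstruction of any residue family is `N`-periodic. [folklore] -/
theorem isPeriodicCfg_recon (N : ℕ) [NeZero N] (A : (Fin d → Fin N) → (Matrix n n ℂ)ˣ) (f : (Fin d → Fin N) → Fin d → (Matrix n n ℂ)ˣ) :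
    IsPeriodicCfg (fun (x : Site d) (κ : Fin d) => (A (redN N x))⁻¹ * f (redN N x) κ * A (redN N (x + e κ))) (N : ℤ) := by
  intro x i κ
  have h1 : redN N (x + (N : ℤ) • e i) = redN N x := redN_add_smul N x (e i)
  have h2 : redN N (x + (N : ℤ) • e i + e κ) = redN N (x + e κ) := by
    rw [show x + (N : ℤ) • e i + e κ = (x + e κ) + (N : ℤ) • e i by abel]
    exact redN_add_smul N (x + e κ) (e i)
  simp only [h1, h2]

/-- The reconstruction of a unitary family by a unitary transport is unitary. [folklore] -/
theorem isUnitaryCfg_recon (N : ℕ) [NeZero N] {A : (Fin d → Fin N) → (Matrix n n ℂ)ˣ} (hA : ∀ r, A r ∈ unitaryUnits (Matrix n n ℂ))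
    {f : (Fin d → Fin N) → Fin d → (Matrix n n ℂ)ˣ} (hf : ∀ r κ, f r κ ∈ unitaryUnits (Matrix n n ℂ)) :
    IsUnitaryCfg (fun (x : Site d) (κ : Fin d) => (A (redN N x))⁻¹ * f (redN N x) κ * A (redN N (x + e κ))) := fun _ _ =>
  (unitaryUnits _).mul_mem ((unitaryUnits _).mul_mem ((unitaryUnits _).inv_mem (hA _)) (hf _ _)) (hA _)

/-- **THE PLAQUETTE HOLONOMY OF THE RECONSTRUCTION IS THE CONJUGATED PLAQUETTE WORD OF THE FAMILY.** [folklore] -/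
theorem hol_recon_plaqWord (N : ℕ) [NeZero N] (A : (Fin d → Fin N) → (Matrix n n ℂ)ˣ) (f : (Fin d → Fin N) → Fin d → (Matrix n n ℂ)ˣ)
    (x : Site d) (κ μ : Fin d) :
    hol (fun (y : Site d) (ν : Fin d) => (A (redN N y))⁻¹ * f (redN N y) ν * A (redN N (y + e ν))) x (plaqWord κ μ)
      = (A (redN N x))⁻¹ * (f (redN N x) κ * f (redN N (x + e κ)) μ * (f (redN N (x + e μ)) κ)⁻¹ * (f (redN N x) μ)⁻¹) * A (redN N x) := by
  simp only [plaqWord, hol_cons, hol_nil, mul_one, stepHol_true, stepHol_false, Letter.vec_true, Letter.vec_false]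
  have e1 : x + e κ + e μ - e κ = x + e μ := by abel
  have e2 : x + e κ + e μ + -e κ = x + e μ := by abel
  have e3 : x + e μ + e κ = x + e κ + e μ := by abel
  have e4 : x + e μ - e μ = x := by abel
  simp only [e1, e2, e3, e4]
  group

/-- **FLATNESS**: if every plaquette word of `f` is `1`, the reconstruction is FLAT (`SmallField · 0`). [folklore] -/
theorem smallField_zero_recon (N : ℕ) [NeZero N] (A : (Fin d → Fin N) → (Matrix n n ℂ)ˣ) (f : (Fin d → Fin N) → Fin d → (Matrix n n ℂ)ˣ)
    (hw : ∀ (x : Site d) (κ μ : Fin d), κ ≠ μ → f (redN N x) κ * f (redN N (x + e κ)) μ * (f (redN N (x + e μ)) κ)⁻¹ * (f (redN N x) μ)⁻¹ = 1) :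
    SmallField (fun (y : Site d) (ν : Fin d) => (A (redN N y))⁻¹ * f (redN N y) ν * A (redN N (y + e ν))) 0 := by
  intro x κ μ hκμ
  rw [hol_recon_plaqWord, hw x κ μ hκμ, mul_one, inv_mul_cancel, Units.val_one, sub_self, norm_zero]

/-- **SYMMETRY**: a gauge field of the form `s(x) = A(x̄)⁻¹ s₀ A(x̄)` with `s₀` commuting with every `f(r,κ)` FIXES the reconstruction. [folklore] -/
theorem gaugeAct_recon_of_conj (N : ℕ) [NeZero N] (A : (Fin d → Fin N) → (Matrix n n ℂ)ˣ) (f : (Fin d → Fin N) → Fin d → (Matrix n n ℂ)ˣ)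
    {s : Site d → (Matrix n n ℂ)ˣ} {s₀ : (Matrix n n ℂ)ˣ} (hs : ∀ x : Site d, s x = (A (redN N x))⁻¹ * s₀ * A (redN N x))
    (hcomm : ∀ r κ, s₀ * f r κ = f r κ * s₀) :
    gaugeAct s (fun (y : Site d) (ν : Fin d) => (A (redN N y))⁻¹ * f (redN N y) ν * A (redN N (y + e ν)))
      = fun (y : Site d) (ν : Fin d) => (A (redN N y))⁻¹ * f (redN N y) ν * A (redN N (y + e ν)) := by
  funext x κ
  simp only [gaugeAct]
  rw [hs x, hs (x + e κ)]
  have h := hcomm (redN N x) κ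
  calc (A (redN N x))⁻¹ * s₀ * A (redN N x) * ((A (redN N x))⁻¹ * f (redN N x) κ * A (redN N (x + e κ))) * ((A (redN N (x + e κ)))⁻¹ * s₀ * A (redN N (x + e κ)))⁻¹
      = (A (redN N x))⁻¹ * (s₀ * f (redN N x) κ) * s₀⁻¹ * A (redN N (x + e κ)) := by group
    _ = (A (redN N x))⁻¹ * (f (redN N x) κ * s₀) * s₀⁻¹ * A (redN N (x + e κ)) := by rw [h]
    _ = (A (redN N x))⁻¹ * f (redN N x) κ * A (redN N (x + e κ)) := by group

/-- **CLOSENESS**: for unitary data, `‖recon(f)(x,κ)⁻¹·V(x,κ) − 1‖ = ‖ℓ(x̄,κ) − f(x̄,κ)‖` where `ℓ` is the loop family of `V` for the same transport. [folklore] -/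
theorem norm_recon_inv_mul_sub_one (N : ℕ) [NeZero N] {A : (Fin d → Fin N) → (Matrix n n ℂ)ˣ} (hA : ∀ r, A r ∈ unitaryUnits (Matrix n n ℂ))
    {f : (Fin d → Fin N) → Fin d → (Matrix n n ℂ)ˣ} (hf : ∀ r κ, f r κ ∈ unitaryUnits (Matrix n n ℂ))
    {V : Site d → Fin d → (Matrix n n ℂ)ˣ} (hV : IsPeriodicCfg V (N : ℤ)) (x : Site d) (κ : Fin d) :
    ‖((((A (redN N x))⁻¹ * f (redN N x) κ * A (redN N (x + e κ)))⁻¹ * V x κ : (Matrix n n ℂ)ˣ) : Matrix n n ℂ) - 1‖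
      = ‖((A (redN N x) * V (boxVec N (redN N x)) κ * (A (redN N (boxVec N (redN N x) + e κ)))⁻¹ : (Matrix n n ℂ)ˣ) : Matrix n n ℂ)
          - (f (redN N x) κ : Matrix n n ℂ)‖ := by
  -- write `V(x,κ)` through its loop variable
  set ℓ : (Matrix n n ℂ)ˣ := A (redN N x) * V (boxVec N (redN N x)) κ * (A (redN N (boxVec N (redN N x) + e κ)))⁻¹ with hℓ
  have hVx : V x κ = (A (redN N x))⁻¹ * ℓ * A (redN N (x + e κ)) := (recon_loop N A hV x κ).symm
  have hunit : ((A (redN N x))⁻¹ * f (redN N x) κ * A (redN N (x + e κ)))⁻¹ * V x κ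
      = (A (redN N (x + e κ)))⁻¹ * ((f (redN N x) κ)⁻¹ * ℓ) * A (redN N (x + e κ)) := by
    rw [hVx]; group
  rw [hunit]
  have hAu : ((A (redN N (x + e κ)) : (Matrix n n ℂ)ˣ) : Matrix n n ℂ) ∈ unitary (Matrix n n ℂ) := mem_unitaryUnits.mp (hA _)
  have hfu : ((f (redN N x) κ : (Matrix n n ℂ)ˣ) : Matrix n n ℂ) ∈ unitary (Matrix n n ℂ) := mem_unitaryUnits.mp (hf _ _)
  have hAinv : (↑((A (redN N (x + e κ)))⁻¹) : Matrix n n ℂ) = star (↑(A (redN N (x + e κ))) : Matrix n n ℂ) :=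
    Units.inv_eq_of_mul_eq_one_right (Unitary.mul_star_self_of_mem hAu)
  have hfinv : (↑((f (redN N x) κ)⁻¹) : Matrix n n ℂ) = star (↑(f (redN N x) κ) : Matrix n n ℂ) :=
    Units.inv_eq_of_mul_eq_one_right (Unitary.mul_star_self_of_mem hfu)
  have hval : (((A (redN N (x + e κ)))⁻¹ * ((f (redN N x) κ)⁻¹ * ℓ) * A (redN N (x + e κ)) : (Matrix n n ℂ)ˣ) : Matrix n n ℂ) - 1
      = star ((A (redN N (x + e κ)) : (Matrix n n ℂ)ˣ) : Matrix n n ℂ)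
        * (star ((f (redN N x) κ : (Matrix n n ℂ)ˣ) : Matrix n n ℂ) * ((ℓ : Matrix n n ℂ) - (f (redN N x) κ : Matrix n n ℂ)))
        * ((A (redN N (x + e κ)) : (Matrix n n ℂ)ˣ) : Matrix n n ℂ) := by
    simp only [Units.val_mul, hAinv, hfinv]
    rw [mul_sub, Unitary.star_mul_self_of_mem hfu, mul_sub, sub_mul, mul_one, Unitary.star_mul_self_of_mem hAu]
  rw [hval, CStarRing.norm_mul_mem_unitary _ hAu, CStarRing.norm_mem_unitary_mul _ (Unitary.star_mem hAu),
    CStarRing.norm_mem_unitary_mul _ (Unitary.star_mem hfu)]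

/-! ## §3 The axial transport: the stabiliser of a periodic configuration in loop coordinates -/

/-- **EVERY PERIODIC GAUGE FIELD FIXING `V` IS THE AXIAL CONJUGATE OF ITS VALUE AT THE ORIGIN**: `s(x) = A(x̄)⁻¹ · s(0) · A(x̄)` with
`A(r) = hol V 0 (treeWord x_r)` (✓ `hol_gaugeAct`, `disp_treeWord`). [folklore] -/
theorem stab_eq_conj_axial (N : ℕ) [NeZero N] {V : Site d → Fin d → (Matrix n n ℂ)ˣ} {s : Site d → (Matrix n n ℂ)ˣ}
    (hsP : IsPeriodicSite s (N : ℤ)) (hfix : gaugeAct s V = V) (x : Site d) :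
    s x = (hol V 0 (treeWord (boxVec N (redN N x))))⁻¹ * s 0 * hol V 0 (treeWord (boxVec N (redN N x))) := by
  set y : Site d := boxVec N (redN N x) with hy
  have h := hol_gaugeAct s V 0 (treeWord y)
  rw [hfix, disp_treeWord, zero_add] at h
  rw [← site_apply_boxVec_redN N hsP x]
  calc s y = (hol V 0 (treeWord y))⁻¹ * (hol V 0 (treeWord y)) * s y := by group
    _ = (hol V 0 (treeWord y))⁻¹ * (s 0 * hol V 0 (treeWord y) * (s y)⁻¹) * s y := by rw [← h]
    _ = (hol V 0 (treeWord y))⁻¹ * s 0 * hol V 0 (treeWord y) := by group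

/-- **THE VALUE AT THE ORIGIN COMMUTES WITH EVERY LOOP VARIABLE**: for `s` periodic fixing the periodic `V`, `s(0)` commutes with
`A(r) V(x_r, κ) A((x_r + e_κ)‾)⁻¹`, `A(r) = hol V 0 (treeWord x_r)`. [folklore] -/
theorem commute_loop_of_stab (N : ℕ) [NeZero N] {V : Site d → Fin d → (Matrix n n ℂ)ˣ} {s : Site d → (Matrix n n ℂ)ˣ}
    (hsP : IsPeriodicSite s (N : ℤ)) (hfix : gaugeAct s V = V) (r : Fin d → Fin N) (κ : Fin d) :
    s 0 * (hol V 0 (treeWord (boxVec N r)) * V (boxVec N r) κ * (hol V 0 (treeWord (boxVec N (redN N (boxVec N r + e κ)))))⁻¹)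
      = (hol V 0 (treeWord (boxVec N r)) * V (boxVec N r) κ * (hol V 0 (treeWord (boxVec N (redN N (boxVec N r + e κ)))))⁻¹) * s 0 := by
  have h1 : s (boxVec N r) = (hol V 0 (treeWord (boxVec N r)))⁻¹ * s 0 * hol V 0 (treeWord (boxVec N r)) := by
    have h := stab_eq_conj_axial N hsP hfix (boxVec N r)
    rwa [redN_boxVec] at h
  have h2 := stab_eq_conj_axial N hsP hfix (boxVec N r + e κ)
  have hb : s (boxVec N r) * V (boxVec N r) κ * (s (boxVec N r + e κ))⁻¹ = V (boxVec N r) κ := congr_fun (congr_fun hfix (boxVec N r)) κ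
  rw [h1, h2] at hb
  set A₁ := hol V 0 (treeWord (boxVec N r)) with hA₁
  set A₂ := hol V 0 (treeWord (boxVec N (redN N (boxVec N r + e κ)))) with hA₂
  -- `A₁⁻¹ s₀ A₁ · V · (A₂⁻¹ s₀ A₂)⁻¹ = V` ⟹ `s₀ (A₁ V A₂⁻¹) = (A₁ V A₂⁻¹) s₀`
  calc s 0 * (A₁ * V (boxVec N r) κ * A₂⁻¹)
      = A₁ * (A₁⁻¹ * s 0 * A₁ * V (boxVec N r) κ * (A₂⁻¹ * s 0 * A₂)⁻¹) * A₂⁻¹ * s 0 := by group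
    _ = A₁ * V (boxVec N r) κ * A₂⁻¹ * s 0 := by rw [hb]

end

end Summit.QuantumFields.BalabanUV.T4Continuum.NE7CombLoopReconstruction
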